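import Summits.ABC.IUTFork.Repair.RHSigmaCellCreditAbcExp
import HarnessLib

/-!
# D-0121 (1)(b) T-OPTIMALITY, the GLUE: every AVERAGING SCHEME `ω` (netting allowed, LP-2) and the FINANCED stratum reading `T′ = T − C_σ` go through
# ONE exponent door — «[W-C](ω) ∧ kept ω-mass ≥ μ_fin·M − Tol ∧ hregC ⟹ abc WITH EXPONENT 1/μ_fin ON EVERY FAR-FROM-CUSPS FAMILY» — so the MIN-SLICE mass
# numbers read as a verdict on the TYPED Cor. 3.12 shape in BOTH readings (licence-only `μ`: abc-iut-rh2-T-1 p485274; financed `μ_fin`: this file)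

PROOF-ONLY file (0 definitions, 0 `Prop` facts, no instance, no notation; nothing re-typed) of the abc-iut cell, rung LADDER-ABC:A2.RESCUE.H; seat abc-iut-topt-pv-3
(D-0121 (1)(b) prover 3/3; rh-lead g3 KICKOFF-2 2026-08-27T02:27:15Z and ROUND3/D0121-SPEC.md v0 §1.2 «topt-pv-3 (GLUE into MIN-SLICE / EXP)»). The human's
ROUND-3 AUDIT question (21-frontier 02:03:16Z): «is the ~j² per-cell weighting FORCED for any derivation of a IV-1.10-type inequality through the Cor 3.12 shape,
or does an on-average-over-labels derivation need strictly less identification mass?» — D0121-SPEC §1.0 fixes ONE currency: an AVERAGING SCHEME is a weight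
`ω : cells → ℝ` (`ω ≤ 1`), the typed Cor. 3.12 shape is the ONE netted inequality `StatementUpTo P ε ⟺ D(P) ≤ ε` (abc-iut-rh2-q2-eq p479556/p480491,
`D = signedRemainder = PN Σᶠ cellDeficit`), «IV-1.10-type with exponent `Λ`» is the relative tolerance `OffSigmaTolerance (1 − 1/Λ) (Tol(P,l)) T ε`, and the
threshold of record is `T(T) = (1 − μ(T))·M(T)` (MIN-SLICE §(ii)/(v), `M = totalTrivialMass = T.gap`). The LP seats (topt-lp-1 / topt-lp-2) compute the LP-2 value `μ_fin`
(netting allowed) per datum; this file is the kernel door that value instantiates, and the closed form of the netted stratum reading.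

COMPOSED BY NAME from: q2-eq's weighted door `RH.SigmaLicence.statementUpTo_weightedTrivialMass_of_weightedDeficit_nonpos` (p480491) and its datum adapter
`RH.SigmaStrataEq.cor312UpTo_{of_statementUpTo,weightedTrivialMass_of_weightedDeficit_nonpos}_chosen` (p484564), abc-iut-rh2-q2-cond's degree-one ε-door
`Conditional.Cor312Slack.ABCExpOn_farFromCusps_of_cor312Slack_mu_content_hregC_degOne` (p484796; rh-lead RULING R21 «F5 (a) PRIMARY PATH = DEGREE ONE», abc-iut-rh2-xi-1
p484356 inside), abc-iut-rh2-w-1 / rh2-T-1's mass bookkeeping `RH.SigmaMass.{onTrivialMass_add_offTrivialMass, totalTrivialMass}` (p477034) and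
`RH.CellWeights.totalTrivialMass_chosen_eq_gap` (p478601).

WHAT IS TYPED (`0 < μ₀ ≤ 1`; `Tol(P,l) = Conditional.SigmaMass.tol P l = ((l+1)/4)·5·d*·l`; cells `c = (i, v_ℚ)`; `d(c) = cellDeficit`, `t(c) = cellTrivialCost`;
`1_σ` the indicator weight of a stratum `σ`; CHOSEN realising ideles at every genuine Θ-volume datum `T`; context binders `M … qData` VERBATIM as in p485439/p485274):
* §1 GENERIC (ANY `P : Cor312.Setting S`, bridge hypotheses). THE FINANCED DOOR IN CLOSED FORM: **`statementUpTo_onCharge_add_offTrivialMass`** — for EVERY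
  stratum `σ`, with NO hypothesis on `σ`, Cor. 3.12 holds up to `F(σ) := weightedDeficit P 1_σ + offTrivialMass P σ` = (signed on-σ charge) + `B_triv(σᶜ)`
  (`D = PN Σ_σ d + PN Σ_{σᶜ} d ≤ PN Σ_σ d + B_triv(σᶜ)`: honest cone off `σ`, NETTING on `σ`). READING (D0121-SPEC §1.1 LP-2(b), «netting across places»): with
  `C_σ := −weightedDeficit P 1_σ` the on-σ surplus (`≥ 0` under the licence, `weightedDeficit_indicator_nonpos_of_licenceOn`), `F(σ) = B_triv(σᶜ) − C_σ`, i.e. the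
  financed threshold **`T′ = T − C_σ`** of the spec, certified WITHOUT choosing any weight; `signedRemainder_le_onCharge_add_offTrivialMass`: `D ≤ F(σ)` (no scheme
  built on `σ` beats the least slack — abc-iut-topt-pv-1's lower-bound side is the information-model converse); `onCharge_add_offTrivialMass_le_offTrivialMass_of_licenceOn`:
  under the licence `F(σ) ≤ B_triv(σᶜ)` — the licence-only door (T-1 p477034 `statementUpTo_offTrivialMass_of_licenceOn`, LP-0) is the financed door with the
  credit thrown away; `onCharge_add_offTrivialMass_le_iff`: `F(σ) ≤ κ·M + A ⟺ (1−κ)·M − A ≤ mass(σ) + C_σ` — THE RE-RUN FUNCTIONAL: in MIN-SLICE currency the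
  financed kept fraction is **`μ_fin(T) := (mass(Σ_data) + C_{Σ_data})/M`** against `μ(T) = mass(Σ_data)/M`; `weightedDoor_indicator_of_licenceOn`: the licence on
  `σ` gives the weighted door's hypotheses for `ω = 1_σ` (so T-1's licence-only F5 is the `ω = 1_σ` INSTANCE of §2 — ONE door, both readings).
* §2 THE EXPONENT ENDS (degree one, transfer-free, R19 shape (a); binders demanded ONLY on abc-iut-C-cert-1's content locus):
  **`abcExpOn_farFromCusps_of_weightedDeficit_nonpos_mu_content_hregC`** — explicit 3 = [W-C] «`ω ≤ 1` cellwise and `weightedDeficit … ω ≤ 0` (net ω-weighted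
  slack `≥ 0`)» · [MU-ω-C] `OffSigmaTolerance (1 − μ₀) (Tol(P,l)) T (weightedTrivialMass … ω)` (⟺ KEPT ω-mass `PN Σᶠ ω·t ≥ μ₀·T.gap − Tol(P,l)`, q2-eq
  `weightedTrivialMass_le_iff_keptMass_ge` + w-1 `totalTrivialMass_chosen_eq_gap`) · [CONE-C] `hregC` VERBATIM ⟹ for every `0 < ρ ≤ 1/2`,
  **`GenEll.ABCWithExponentOn {λ | λ ρ-far from the cusps at ∞, 2} (1/μ₀)`** — the D0121-SPEC sentence «[W-C](ω) ∧ kept ω-mass ≥ μ_fin·gap − Tol ∧ [CONE-C] ⟹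
  abc with exponent `1/μ_fin` on every far-from-cusps family», `μ_fin` = the LP-2 value's symbol `μ₀`; and **`abcExpOn_farFromCusps_of_financed_mu_content_hregC`** —
  explicit 2 = [MU-fin-C] `OffSigmaTolerance (1 − μ₀) (Tol(P,l)) T (F(σ P l T))` · [CONE-C], NO licence / door binder (the financed slack of ANY stratum is
  certified at every datum by §1), the netted-stratum reading the LP-2(b) optimum instantiates with `σ := Σ_data`.
READINGS, side by side (one door, three tolerances at a licensed `σ`): `D(T) ≤ F(σ) ≤ B_triv(σᶜ)`, so [MU-C](σ) (T-1, LP-0, exponent `1/μ`) ⟹ [MU-fin-C](σ)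
(this file, LP-2(b), exponent `1/μ_fin`) ⟹ [MU-D-C] (q2-eq p485439 §4, the least slack); whether `μ_fin` is materially larger than `μ` on the Szpiro-bad bed is the
LP seats' number (topt-lp-1 / topt-lp-2, two engines), not asserted here.
HONEST FRAMING: CONDITIONAL; «the abc-type sentences follow from the displayed hypotheses AS TYPED», nothing more; [W-C] / [MU-·-C] / [CONE-C] are ASSUMPTION
LABELS, never asserted, refutable datum by datum; NO tabulated datum lies on the content locus (MIN-SLICE (iii): 0/781); the financed slack `F(σ)` is a DEFINED
number of OUR typed hull at the chosen ideles, not a claim about print; nothing here asserts that abc (with any exponent) is proved or refuted, or that [IUTchIII]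
Cor. 3.12 / [IUTchIV] Thm. 1.10 holds or fails at any datum, or takes a side on any author (Mochizuki / Scholze–Stix / Joshi / Dupuy–Hilado); typed ≠ proved;
computed ≠ proved; instantiated ≠ endorsed. [claim: Mochizuki2012, status: disputed] for every IUT locution.
[cite: Mochizuki2012, IUTchIII Cor. 3.12 p. 173–174, Prop. 3.9 (i)(iii) p. 116; IUTchIV Thm. 1.10 pp. 22–31, Cor. 2.2 (ii)–(iii) pp. 41–48]
[cite: MochizukiGenEll2010, Thm 2.1 p.12] [cite: DupuyHilado2025, §3.9] Axioms: standard.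
-/

noncomputable section

open Set Function NumberField IsDedekindDomain

/-! ## §1. Generic: the financed door in closed form, its place between the least slack and the licence-only door, the kept-mass reading, the glue -/

namespace Summit.ABC.IUTFork.Conditional.SigmaMass

open Summit.ABC.IUTFork.Thm311 Summit.ABC.IUTFork.Thm311.Real Summit.ABC.IUTFork.Cor312 Summit.ABC.IUTFork.Cor312.Setting
  Summit.ABC.IUTFork.Cor312Vol Summit.ABC.IUTFork.Cor312Prov Literature.IUT.LogThetaLattice Literature.IUT.LogVolume
  Literature.IUT.HodgeTheaters Literature.IUT.LogVolume.ThetaData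
  Literature.NumberTheory.DiophantineGeometry Literature.NumberTheory.DiophantineGeometry.GenEll Summit.ABC.ABC.Theorems
  Summit.ABC.IUTFork.Repair.RH.SigmaLicence Summit.ABC.IUTFork.Repair.RH.SigmaStrataEq Summit.ABC.IUTFork.Repair.RH.SigmaMass
  Summit.ABC.IUTFork.Repair.RH.OffSigma Summit.ABC.IUTFork.Conditional

section Generic

variable {ι : ThetaIndex} {S : Situation ι} {P : Cor312.Setting S}

/-- **`D ≤ F(σ)`: the least slack never exceeds the financed slack of a stratum** — `signedRemainder P ≤ weightedDeficit P 1_σ + offTrivialMass P σ` for EVERY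
`σ` (q2-eq `signedRemainder_le_weightedDeficit_add_weightedTrivialMass` at the indicator weight, `weightedTrivialMass_indicator`). READING: no averaging scheme
built on the stratum `σ` certifies a tolerance below `D(P)` (`statementUpTo_iff_signedRemainder_le`). [claim: Mochizuki2012, status: disputed] -/
theorem signedRemainder_le_onCharge_add_offTrivialMass (H : BridgeHyps P) (σ : Set (Fin ι.lstar × ι.VQ)) :
    signedRemainder P ≤ weightedDeficit P (σ.indicator fun _ => (1 : ℝ)) + offTrivialMass P σ := by
  have h := signedRemainder_le_weightedDeficit_add_weightedTrivialMass H (ω := σ.indicator fun _ => (1 : ℝ)) fun c => by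
    by_cases hc : c ∈ σ
    · rw [Set.indicator_of_mem hc]
    · rw [Set.indicator_of_notMem hc]; exact zero_le_one
  rwa [weightedTrivialMass_indicator] at h

/-- **THE FINANCED DOOR IN CLOSED FORM (D0121-SPEC §1.1 LP-2(b), «T′ = T − C_σ»).** Under the bridge hypotheses, for EVERY stratum `σ` and with NO hypothesis
on it: `StatementUpTo P (weightedDeficit P 1_σ + offTrivialMass P σ)` — Cor. 3.12 holds up to `F(σ) :=` (signed on-σ charge) + `B_triv(σᶜ)`, i.e. up to
`B_triv(σᶜ) − C_σ` with `C_σ = −PN Σᶠ_{c ∈ σ} d(c)` the NETTED on-σ surplus: the cells of `σ` enter with their exact (signed) deficit, the cells off `σ` with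
the honest cone `d ≤ t`. No weight is chosen: this is the value every ω «`= 1` on `σ`, financing off `σ`» can at best certify (q2-eq `statementUpTo_of_weightedDeficit_le`
at `ω = 1_σ`, `δ := weightedDeficit P 1_σ`). «holds AS TYPED for OUR hull»; no side taken. [cite: Mochizuki2012, IUTchIII Cor. 3.12 p. 173–174] [claim: Mochizuki2012, status: disputed] -/
theorem statementUpTo_onCharge_add_offTrivialMass (H : BridgeHyps P) (σ : Set (Fin ι.lstar × ι.VQ)) :
    StatementUpTo P (weightedDeficit P (σ.indicator fun _ => (1 : ℝ)) + offTrivialMass P σ) :=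
  (statementUpTo_iff_signedRemainder_le H _).mpr (signedRemainder_le_onCharge_add_offTrivialMass H σ)

/-- **Under the licence the financed slack is at most the licence-only slack**: `LicenceOn P σ ⟹ F(σ) ≤ B_triv(σᶜ)` (the on-σ charge is `≤ 0`,
q2-eq `weightedDeficit_indicator_nonpos_of_licenceOn`). So abc-iut-rh2-T-1's licence-only door (LP-0, `statementUpTo_offTrivialMass_of_licenceOn`) is the financed
door with the credit `C_σ` thrown away. [claim: Mochizuki2012, status: disputed] -/
theorem onCharge_add_offTrivialMass_le_offTrivialMass_of_licenceOn (H : BridgeHyps P) {σ : Set (Fin ι.lstar × ι.VQ)} (hσ : LicenceOn P σ) :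
    weightedDeficit P (σ.indicator fun _ => (1 : ℝ)) + offTrivialMass P σ ≤ offTrivialMass P σ := by
  linarith [weightedDeficit_indicator_nonpos_of_licenceOn H hσ]

/-- **THE RE-RUN FUNCTIONAL (kept mass + credit).** `F(σ) ≤ κ·M + A ⟺ (1−κ)·M − A ≤ mass(σ) + C_σ` with `C_σ = −weightedDeficit P 1_σ`
(`mass(σ) + B_triv(σᶜ) = M`, p477034). With `κ = 1 − μ₀`, `A = Tol(P,l)`, `M = T.gap`: the financed relative tolerance reads «`mass(Σ) + C_Σ ≥ μ₀·M − Tol`», so the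
number MIN-SLICE v2 tabulates per datum is **`μ_fin(T) = (mass(Σ_data) + C_{Σ_data})/M`** next to `μ(T) = mass(Σ_data)/M` (D0121-SPEC §1.1: `T′/T`). [folklore] -/
theorem onCharge_add_offTrivialMass_le_iff (H : BridgeHyps P) (σ : Set (Fin ι.lstar × ι.VQ)) (κ A : ℝ) :
    weightedDeficit P (σ.indicator fun _ => (1 : ℝ)) + offTrivialMass P σ ≤ κ * totalTrivialMass P + A ↔
      (1 - κ) * totalTrivialMass P - A ≤ onTrivialMass P σ + -weightedDeficit P (σ.indicator fun _ => (1 : ℝ)) := by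
  rw [← onTrivialMass_add_offTrivialMass H σ]
  constructor <;> intro h <;> linarith

/-- **THE GLUE — licence-only is the indicator instance of the weighted door**: `LicenceOn P σ` gives [W] for `ω = 1_σ`, i.e. `1_σ ≤ 1` cellwise and
`weightedDeficit P 1_σ ≤ 0`; and `weightedTrivialMass P 1_σ = offTrivialMass P σ` (p480491 `weightedTrivialMass_indicator`). Hence abc-iut-rh2-T-1's F5
([LIC-C]·[MU-C]·[CONE-C], p485274) is §2's weighted end at `ω := 1_σ`: ONE door, both readings. [claim: Mochizuki2012, status: disputed] -/
theorem weightedDoor_indicator_of_licenceOn (H : BridgeHyps P) {σ : Set (Fin ι.lstar × ι.VQ)} (hσ : LicenceOn P σ) :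
    (∀ c : Fin ι.lstar × ι.VQ, σ.indicator (fun _ => (1 : ℝ)) c ≤ 1) ∧ weightedDeficit P (σ.indicator fun _ => (1 : ℝ)) ≤ 0 := by
  refine ⟨fun c => ?_, weightedDeficit_indicator_nonpos_of_licenceOn H hσ⟩
  by_cases hc : c ∈ σ
  · rw [Set.indicator_of_mem hc]
  · rw [Set.indicator_of_notMem hc]; exact zero_le_one

/-- **[MU-ω] IN KEPT-MASS CURRENCY** (generic): `weightedTrivialMass P ω ≤ κ·M + A ⟺ (1−κ)·M − A ≤ PN Σᶠ ω·t` — q2-eq `weightedTrivialMass_le_iff_keptMass_ge` with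
the kept mass SPELLED OUT (`weightedTrivialMass_compl_eq`): the D0121-SPEC sentence «kept ω-mass `≥ μ_fin·M − Tol`». [folklore] -/
theorem weightedTrivialMass_le_iff_keptMass_ge' (H : BridgeHyps P) (ω : Fin ι.lstar × ι.VQ → ℝ) (κ A : ℝ) :
    weightedTrivialMass P ω ≤ κ * totalTrivialMass P + A ↔
      (1 - κ) * totalTrivialMass P - A ≤
        processionNormalized fun i : Fin ι.lstar => ∑ᶠ vQ : ι.VQ, ω (i, vQ) * cellTrivialCost P (i, vQ) := by
  rw [weightedTrivialMass_le_iff_keptMass_ge H ω κ A, weightedTrivialMass_compl_eq]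

end Generic

end Summit.ABC.IUTFork.Conditional.SigmaMass

/-! ## §2. The exponent ends (degree one, transfer-free): the weighted scheme `ω` and the financed stratum `σ` -/

namespace Summit.ABC.IUTFork.Conditional.SigmaMass

open Summit.ABC.IUTFork.Thm311 Summit.ABC.IUTFork.Thm311.Real Summit.ABC.IUTFork.Cor312 Summit.ABC.IUTFork.Cor312.Setting
  Summit.ABC.IUTFork.Cor312Vol Summit.ABC.IUTFork.Cor312Prov Literature.IUT.LogThetaLattice Literature.IUT.LogVolume
  Literature.IUT.HodgeTheaters Literature.IUT.LogVolume.ThetaData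
  Literature.NumberTheory.DiophantineGeometry Literature.NumberTheory.DiophantineGeometry.GenEll Summit.ABC.ABC.Theorems
  Summit.ABC.IUTFork.Repair.RH.SigmaLicence Summit.ABC.IUTFork.Repair.RH.SigmaStrataEq Summit.ABC.IUTFork.Repair.RH.SigmaMass
  Summit.ABC.IUTFork.Repair.RH.OffSigma Summit.ABC.IUTFork.Conditional

section Ends

variable
    (M : ∀ (P : NFPoint) (l : ℕ) (T : Cor22.ThetaVolumeDatumAt P l), Type) [∀ P l T, Field (M P l T)] [∀ P l T, NumberField (M P l T)]
    (archPk : ∀ (P : NFPoint) (l : ℕ) (T : Cor22.ThetaVolumeDatumAt P l), letI := T.instFieldF; letI := T.instNumberFieldF; letI := T.instAlgebraF; letI := T.instFieldK;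
        letI := T.instNumberFieldK; letI := T.instAlgebraK; letI := T.instFieldFbar; letI := T.instAlgebraFbar;
        letI := T.instAlgebraKFbar; letI := T.instIsElliptic;
      ∀ (j : (thetaIndex (pilotDataOfK T.D T.K)).Label) (vQ : (thetaIndex (pilotDataOfK T.D T.K)).VQ), Set ((logShellsDH (pilotDataOfK T.D T.K) (analyticLogv T.K)).Packet j vQ))
    (archSub : ∀ (P : NFPoint) (l : ℕ) (T : Cor22.ThetaVolumeDatumAt P l), letI := T.instFieldF; letI := T.instNumberFieldF; letI := T.instAlgebraF; letI := T.instFieldK;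
        letI := T.instNumberFieldK; letI := T.instAlgebraK; letI := T.instFieldFbar; letI := T.instAlgebraFbar;
        letI := T.instAlgebraKFbar; letI := T.instIsElliptic;
      ∀ (j : (thetaIndex (pilotDataOfK T.D T.K)).Label) (v : (thetaIndex (pilotDataOfK T.D T.K)).V), Set ((logShellsDH (pilotDataOfK T.D T.K) (analyticLogv T.K)).Packet j ((thetaIndex (pilotDataOfK T.D T.K)).over v)))
    (Ψ : ∀ (P : NFPoint) (l : ℕ) (T : Cor22.ThetaVolumeDatumAt P l), letI := T.instFieldF; letI := T.instNumberFieldF; letI := T.instAlgebraF; letI := T.instFieldK;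
        letI := T.instNumberFieldK; letI := T.instAlgebraK; letI := T.instFieldFbar; letI := T.instAlgebraFbar;
        letI := T.instAlgebraKFbar; letI := T.instIsElliptic;
      ℤ → ∀ v : (thetaIndex (pilotDataOfK T.D T.K)).V, v ∈ (thetaIndex (pilotDataOfK T.D T.K)).Vbad → Set ((logShellsDH (pilotDataOfK T.D T.K) (analyticLogv T.K)).StarPacket v))
    (act : ∀ (P : NFPoint) (l : ℕ) (T : Cor22.ThetaVolumeDatumAt P l), letI := T.instFieldF; letI := T.instNumberFieldF; letI := T.instAlgebraF; letI := T.instFieldK;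
        letI := T.instNumberFieldK; letI := T.instAlgebraK; letI := T.instFieldFbar; letI := T.instAlgebraFbar;
        letI := T.instAlgebraKFbar; letI := T.instIsElliptic;
      ℤ → ∀ v : (thetaIndex (pilotDataOfK T.D T.K)).V, v ∈ (thetaIndex (pilotDataOfK T.D T.K)).Vbad → (logShellsDH (pilotDataOfK T.D T.K) (analyticLogv T.K)).StarPacket v → Module.End ℚ ((logShellsDH (pilotDataOfK T.D T.K) (analyticLogv T.K)).StarPacket v))
    (Mmod : ∀ (P : NFPoint) (l : ℕ) (T : Cor22.ThetaVolumeDatumAt P l), letI := T.instFieldF; letI := T.instNumberFieldF; letI := T.instAlgebraF; letI := T.instFieldK;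
        letI := T.instNumberFieldK; letI := T.instAlgebraK; letI := T.instFieldFbar; letI := T.instAlgebraFbar;
        letI := T.instAlgebraKFbar; letI := T.instIsElliptic;
      ℤ → ∀ j : (thetaIndex (pilotDataOfK T.D T.K)).LabelStar, Set ((logShellsDH (pilotDataOfK T.D T.K) (analyticLogv T.K)).GlobalPacket j.1))
    (region : ∀ (P : NFPoint) (l : ℕ) (T : Cor22.ThetaVolumeDatumAt P l), letI := T.instFieldF; letI := T.instNumberFieldF; letI := T.instAlgebraF; letI := T.instFieldK;
        letI := T.instNumberFieldK; letI := T.instAlgebraK; letI := T.instFieldFbar; letI := T.instAlgebraFbar;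
        letI := T.instAlgebraKFbar; letI := T.instIsElliptic;
      ℤ → ∀ j : (thetaIndex (pilotDataOfK T.D T.K)).LabelStar, FinDivisor (M P l T) → ∀ vQ : (thetaIndex (pilotDataOfK T.D T.K)).VQ, Set ((logShellsDH (pilotDataOfK T.D T.K) (analyticLogv T.K)).Packet j.1 vQ))
    (n : ∀ (P : NFPoint) (l : ℕ) (T : Cor22.ThetaVolumeDatumAt P l), ℤ)
    {HT : ∀ (P : NFPoint) (l : ℕ) (T : Cor22.ThetaVolumeDatumAt P l), Type} {LogLink : ∀ (P : NFPoint) (l : ℕ) (T : Cor22.ThetaVolumeDatumAt P l), HT P l T → HT P l T → Type}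
    {IsFull : ∀ (P : NFPoint) (l : ℕ) (T : Cor22.ThetaVolumeDatumAt P l), ∀ {s t : HT P l T}, LogLink P l T s t → Prop}
    (lat : ∀ (P : NFPoint) (l : ℕ) (T : Cor22.ThetaVolumeDatumAt P l), LGPGaussianLogThetaLattice (LogLink P l T) (IsFull P l T))
    {Frd : ∀ (P : NFPoint) (l : ℕ) (T : Cor22.ThetaVolumeDatumAt P l), Type} {IsoF : ∀ (P : NFPoint) (l : ℕ) (T : Cor22.ThetaVolumeDatumAt P l), Frd P l T → Frd P l T → Type} {Ob : ∀ (P : NFPoint) (l : ℕ) (T : Cor22.ThetaVolumeDatumAt P l), Frd P l T → Type}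
    {realify : ∀ (P : NFPoint) (l : ℕ) (T : Cor22.ThetaVolumeDatumAt P l), Frd P l T → Frd P l T} {Strip : ∀ (P : NFPoint) (l : ℕ) (T : Cor22.ThetaVolumeDatumAt P l), Type} {IsoS : ∀ (P : NFPoint) (l : ℕ) (T : Cor22.ThetaVolumeDatumAt P l), Strip P l T → Strip P l T → Type}
    {Mv : ∀ (P : NFPoint) (l : ℕ) (T : Cor22.ThetaVolumeDatumAt P l), letI := T.instFieldF; letI := T.instNumberFieldF; letI := T.instAlgebraF; letI := T.instFieldK;
        letI := T.instNumberFieldK; letI := T.instAlgebraK; letI := T.instFieldFbar; letI := T.instAlgebraFbar;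
        letI := T.instAlgebraKFbar; letI := T.instIsElliptic;
      ∀ v : (thetaIndex (pilotDataOfK T.D T.K)).V, v ∈ (thetaIndex (pilotDataOfK T.D T.K)).Vbad → Type}
    [∀ P l T v h, Monoid (Mv P l T v h)]
    (sig : ∀ (P : NFPoint) (l : ℕ) (T : Cor22.ThetaVolumeDatumAt P l), letI := T.instFieldF; letI := T.instNumberFieldF; letI := T.instAlgebraF; letI := T.instFieldK;
        letI := T.instNumberFieldK; letI := T.instAlgebraK; letI := T.instFieldFbar; letI := T.instAlgebraFbar;
        letI := T.instAlgebraKFbar; letI := T.instIsElliptic;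
      GlobalLGPFrobenioidSignature (thetaIndex (pilotDataOfK T.D T.K)).lstar (thetaIndex (pilotDataOfK T.D T.K)).V (· ∈ (thetaIndex (pilotDataOfK T.D T.K)).Vbad) (Frd P l T) (IsoF P l T) (Ob P l T) (realify P l T)
        (Strip P l T) (IsoS P l T) (Mv P l T))
    (split : ∀ (P : NFPoint) (l : ℕ) (T : Cor22.ThetaVolumeDatumAt P l), SplittingMonoids (Mv P l T))
    {ObΔ : ∀ (P : NFPoint) (l : ℕ) (T : Cor22.ThetaVolumeDatumAt P l), Type} {N : ∀ (P : NFPoint) (l : ℕ) (T : Cor22.ThetaVolumeDatumAt P l), letI := T.instFieldF; letI := T.instNumberFieldF; letI := T.instAlgebraF; letI := T.instFieldK;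
        letI := T.instNumberFieldK; letI := T.instAlgebraK; letI := T.instFieldFbar; letI := T.instAlgebraFbar;
        letI := T.instAlgebraKFbar; letI := T.instIsElliptic;
      ∀ v : (thetaIndex (pilotDataOfK T.D T.K)).V, v ∈ (thetaIndex (pilotDataOfK T.D T.K)).Vbad → Type}
    [∀ P l T v h, Monoid (N P l T v h)] (qData : ∀ (P : NFPoint) (l : ℕ) (T : Cor22.ThetaVolumeDatumAt P l), QPilotData (ObΔ P l T) (N P l T))

include M archPk archSub Ψ act Mmod region n lat sig split qData

/-- **`abcExpOn_farFromCusps_of_weightedDeficit_nonpos_mu_content_hregC` — THE D-0121 GLUE THEOREM: ANY AVERAGING SCHEME `ω` (netting allowed) ⟹ abc WITH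
EXPONENT `1/μ₀` ON EVERY FAR-FROM-CUSPS FAMILY** (`0 < μ₀ ≤ 1`; `μ₀` = the LP-2 value's symbol `μ_fin` of D0121-SPEC §1.1). Explicit 3 = [W-C] 1 · [MU-ω-C] 1 ·
[CONE-C] 1, for a datum-dependent weight `ω P l T` on the cells of the chosen bed: IF at every admissible `(P, l)` on the content locus «`6·(1 + 20·d_mod/l)·
(log-diff + log-cond) + 120·d*·l < log q^{∤{2,l}}`» and every genuine Θ-volume datum `T` [W-C] THE WEIGHTED DOOR's hypotheses hold (`ω ≤ 1` cellwise and
`weightedDeficit … ω ≤ 0`: the ω-NETTED slack of OUR typed hull is `≥ 0` — the AGGREGATE condition, p480491), [MU-ω-C] the charged mass `PN Σᶠ (1−ω)·t` is within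
the RELATIVE tolerance `(1 − μ₀)·T.gap + Tol(P,l)` (⟺ KEPT ω-mass `≥ μ₀·T.gap − Tol(P,l)`, §1 `weightedTrivialMass_le_iff_keptMass_ge'`, `M = T.gap` w-1 p478601),
and [CONE-C] `hregC` (VERBATIM), THEN for every `0 < ρ ≤ 1/2`: **`GenEll.ABCWithExponentOn {λ | λ ρ-far from the cusps at ∞ and 2} (1/μ₀)`** — `∀ ε > 0 ∃ C =
C(ρ,ε) > 0`, `c < C·rad(abc)^{(1/μ₀)(1+ε)}` for every abc triple with `min(a,b) ≥ ρ·c ∧ 2^{v₂(abc)} ≤ 1/ρ`. Route (R21, degree one): q2-eq's datum adapter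
`cor312UpTo_weightedTrivialMass_of_weightedDeficit_nonpos_chosen` DISCHARGES q2-cond's [NUMΣ-C] with `ε := weightedTrivialMass … ω`, then
`Cor312Slack.ABCExpOn_farFromCusps_of_cor312Slack_mu_content_hregC_degOne` (xi-1 p484356 inside). `ω = 1_σ`: T-1's F5 (p485274) by §1
`weightedDoor_indicator_of_licenceOn` + `weightedTrivialMass_indicator`. CONDITIONAL; «follows from these hypotheses AS TYPED»; nothing asserted about any datum
or any scheme; no side taken. [cite: Mochizuki2012, IUTchIV Thm. 1.10 pp. 22–31; Cor. 2.2 (ii)–(iii) pp. 41–48] [cite: Mochizuki2012, IUTchIII Cor. 3.12 p. 173–174]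
[cite: MochizukiGenEll2010, Thm 2.1 p.12] [claim: Mochizuki2012, status: disputed] -/
theorem abcExpOn_farFromCusps_of_weightedDeficit_nonpos_mu_content_hregC (μ₀ : ℝ) (hμ₀ : 0 < μ₀) (hμ₁ : μ₀ ≤ 1)
    (ω : ∀ (P : NFPoint) (l : ℕ) (T : Cor22.ThetaVolumeDatumAt P l), letI := T.instFieldF; letI := T.instNumberFieldF; letI := T.instAlgebraF; letI := T.instFieldK;
        letI := T.instNumberFieldK; letI := T.instAlgebraK; letI := T.instFieldFbar; letI := T.instAlgebraFbar;
        letI := T.instAlgebraKFbar; letI := T.instIsElliptic;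
      Fin (thetaIndex (pilotDataOfK T.D T.K)).lstar × (thetaIndex (pilotDataOfK T.D T.K)).VQ → ℝ)
    -- [W-C] THE WEIGHTED DOOR's hypotheses at the chosen bed (net ω-weighted slack ≥ 0, ω ≤ 1), demanded ONLY on the content locus
    (hWC : ∀ P : NFPoint, P ∈ UP → ∀ l : ℕ, l.Prime → 5 ≤ l →
      Cor22.AdmitsCore P → Cor22.CondP2 P l → Cor22.CondP5 P l → Cor22.CondP6 P l →
      6 * ((1 + 20 * (Cor22.dmod P : ℝ) / l) * (P.logDiff + Cor22.logCondAvoid P {2, l}))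
          + 120 * (2 ^ 12 * 3 ^ 3 * 5 * (Cor22.dmod P : ℝ) * l) < Cor22.logQAvoid P {2, l} →
      ∀ T : Cor22.ThetaVolumeDatumAt P l, letI := T.instFieldF; letI := T.instNumberFieldF; letI := T.instAlgebraF; letI := T.instFieldK;
        letI := T.instNumberFieldK; letI := T.instAlgebraK; letI := T.instFieldFbar; letI := T.instAlgebraFbar;
        letI := T.instAlgebraKFbar; letI := T.instIsElliptic;
      (∀ c : Fin (thetaIndex (pilotDataOfK T.D T.K)).lstar × (thetaIndex (pilotDataOfK T.D T.K)).VQ, ω P l T c ≤ 1) ∧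
        weightedDeficit
          (settingPrVolSharp (pilotDataOfK T.D T.K) (logvAnalytic_analyticLogv (F := T.K)) (M P l T) (archPk P l T) (archSub P l T) (Ψ P l T)
            (act P l T) (Mmod P l T) (region P l T) (n P l T) (lat P l T) (sig P l T) (split P l T) (qData P l T)
            (exists_realising_qIdeles_pilotDataOfK T.D).choose
            (exists_realising_thetaIdeles_pilotDataOfK T.D).choose
            (exists_realising_qIdeles_pilotDataOfK T.D).choose_spec.1
            (exists_realising_qIdeles_pilotDataOfK T.D).choose_spec.2.1) (ω P l T) ≤ 0)
    -- [MU-ω-C] the charged mass is within the RELATIVE tolerance `(1 − μ₀)·T.gap + Tol(P,l)` (⟺ kept ω-mass ≥ μ₀·T.gap − Tol), demanded ONLY there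
    (hMuC : ∀ P : NFPoint, P ∈ UP → ∀ l : ℕ, l.Prime → 5 ≤ l →
      Cor22.AdmitsCore P → Cor22.CondP2 P l → Cor22.CondP5 P l → Cor22.CondP6 P l →
      6 * ((1 + 20 * (Cor22.dmod P : ℝ) / l) * (P.logDiff + Cor22.logCondAvoid P {2, l}))
          + 120 * (2 ^ 12 * 3 ^ 3 * 5 * (Cor22.dmod P : ℝ) * l) < Cor22.logQAvoid P {2, l} →
      ∀ T : Cor22.ThetaVolumeDatumAt P l, letI := T.instFieldF; letI := T.instNumberFieldF; letI := T.instAlgebraF; letI := T.instFieldK;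
        letI := T.instNumberFieldK; letI := T.instAlgebraK; letI := T.instFieldFbar; letI := T.instAlgebraFbar;
        letI := T.instAlgebraKFbar; letI := T.instIsElliptic;
      OffSigmaTolerance (1 - μ₀) (tol P l) T
        (weightedTrivialMass
          (settingPrVolSharp (pilotDataOfK T.D T.K) (logvAnalytic_analyticLogv (F := T.K)) (M P l T) (archPk P l T) (archSub P l T) (Ψ P l T)
            (act P l T) (Mmod P l T) (region P l T) (n P l T) (lat P l T) (sig P l T) (split P l T) (qData P l T)
            (exists_realising_qIdeles_pilotDataOfK T.D).choose
            (exists_realising_thetaIdeles_pilotDataOfK T.D).choose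
            (exists_realising_qIdeles_pilotDataOfK T.D).choose_spec.1
            (exists_realising_qIdeles_pilotDataOfK T.D).choose_spec.2.1) (ω P l T)))
    -- [CONE-C] abc-iut-C-cert-1's `hregC` VERBATIM (the off-regime hull estimate with print's `B_III(P,l)`, ONLY on the content locus)
    (hregC : ∀ P : NFPoint, P ∈ UP → ∀ l : ℕ, l.Prime → 5 ≤ l →
      Cor22.AdmitsCore P → Cor22.CondP2 P l → Cor22.CondP5 P l → Cor22.CondP6 P l →
      6 * ((1 + 20 * (Cor22.dmod P : ℝ) / l) * (P.logDiff + Cor22.logCondAvoid P {2, l}))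
          + 120 * (2 ^ 12 * 3 ^ 3 * 5 * (Cor22.dmod P : ℝ) * l) < Cor22.logQAvoid P {2, l} →
      ∀ T : Cor22.ThetaVolumeDatumAt P l,
        (letI := T.instFieldF; letI := T.instNumberFieldF; letI := T.instAlgebraF; letI := T.instFieldK
         letI := T.instNumberFieldK; letI := T.instAlgebraK; letI := T.instFieldFbar; letI := T.instAlgebraFbar
         letI := T.instAlgebraKFbar; letI := T.instIsElliptic
         ¬ (∀ p ∈ T.I.supportPrimes, ∀ v w : placesOver (fieldOfModuli T.E) p,
            (Summit.ABC.IUTFork.DHData.ofInput T.I).logQloc p v = (Summit.ABC.IUTFork.DHData.ofInput T.I).logQloc p w)) →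
        T.HullEstimateOf
          (((l : ℝ) + 1) / 4 *
            ((1 + 12 * (Cor22.dmod P : ℝ) / l) * (P.logDiff + Cor22.logCondAvoid P {2, l})
              + 2 * Real.log l + 52
              + 20 / 3 * Real.log (((2 ^ 12 * 3 ^ 3 * 5 * Cor22.dmod P : ℕ) : ℝ) * (l : ℝ))
                * (Nat.primeCounting (2 ^ 12 * 3 ^ 3 * 5 * Cor22.dmod P * l) : ℝ))))
    {ρ : ℝ} (h0 : 0 < ρ) (h2 : ρ ≤ 1 / 2) :
    ABCWithExponentOn {P : NFPoint | P.FarFromCusps ({2} : Finset ℕ) ρ} (1 / μ₀) :=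
  Cor312Slack.ABCExpOn_farFromCusps_of_cor312Slack_mu_content_hregC_degOne μ₀ hμ₀ hμ₁
    (fun P l T => letI := T.instFieldF; letI := T.instNumberFieldF; letI := T.instAlgebraF; letI := T.instFieldK;
        letI := T.instNumberFieldK; letI := T.instAlgebraK; letI := T.instFieldFbar; letI := T.instAlgebraFbar;
        letI := T.instAlgebraKFbar; letI := T.instIsElliptic;
      weightedTrivialMass
          (settingPrVolSharp (pilotDataOfK T.D T.K) (logvAnalytic_analyticLogv (F := T.K)) (M P l T) (archPk P l T) (archSub P l T) (Ψ P l T)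
            (act P l T) (Mmod P l T) (region P l T) (n P l T) (lat P l T) (sig P l T) (split P l T) (qData P l T)
            (exists_realising_qIdeles_pilotDataOfK T.D).choose
            (exists_realising_thetaIdeles_pilotDataOfK T.D).choose
            (exists_realising_qIdeles_pilotDataOfK T.D).choose_spec.1
            (exists_realising_qIdeles_pilotDataOfK T.D).choose_spec.2.1) (ω P l T))
    (fun P hP l hl h5 hcore hP2 hP5 hP6 hct T =>
      cor312UpTo_weightedTrivialMass_of_weightedDeficit_nonpos_chosen T (M P l T) (archPk P l T) (archSub P l T) (Ψ P l T) (act P l T) (Mmod P l T)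
        (region P l T) (n P l T) (lat P l T) (sig P l T) (split P l T) (qData P l T) (ω P l T)
        (hWC P hP l hl h5 hcore hP2 hP5 hP6 hct T).1 (hWC P hP l hl h5 hcore hP2 hP5 hP6 hct T).2)
    hMuC hregC h0 h2

/-- **`abcExpOn_farFromCusps_of_financed_mu_content_hregC` — THE FINANCED STRATUM READING (LP-2(b) closed form `T′ = T − C_σ`) ⟹ abc WITH EXPONENT `1/μ₀`
ON EVERY FAR-FROM-CUSPS FAMILY** (`0 < μ₀ ≤ 1`). Explicit 2 = [MU-fin-C] 1 · [CONE-C] 1, for a FREE stratum `σ P l T` — NO licence binder, NO door binder: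
IF at every admissible `(P, l)` on the content locus and every genuine Θ-volume datum `T` the FINANCED slack of `σ` for OUR typed hull at the chosen ideles,
`F(σ) = weightedDeficit … 1_σ + offTrivialMass … σ` (= `B_triv(σᶜ) − C_σ`, §1), is within the relative tolerance, `OffSigmaTolerance (1 − μ₀) (Tol(P,l)) T (F(σ))`
(⟺ `mass(σ) + C_σ ≥ μ₀·T.gap − Tol(P,l)`, §1 `onCharge_add_offTrivialMass_le_iff`: KEPT-PLUS-CREDIT fraction `μ_fin ≥ μ₀` up to `Tol/M`), and [CONE-C] `hregC`
(VERBATIM), THEN for every `0 < ρ ≤ 1/2`: **`GenEll.ABCWithExponentOn {λ | λ ρ-far from the cusps at ∞ and 2} (1/μ₀)`**. [NUMΣ-C] DISCHARGED hypothesis-free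
by §1 `statementUpTo_onCharge_add_offTrivialMass` ∘ q2-eq's adapter `cor312UpTo_of_statementUpTo_chosen`; door = q2-cond's degree-one ε-door (R21). With
`σ := Σ_data` (the licensed initial segments, SLICE.md) this is the sentence the LP-2(b) optimum `μ_fin(T)` instantiates; `σ := ∅`: `F = M` (bounded-height junk
band, T-1 `offTrivialMass_empty`); `σ := univ`: `F = D(T)` (q2-eq p485439 §4, the least slack). CONDITIONAL; [MU-fin-C] is an assumption label on a DEFINED
datum number; nothing asserted about any datum; no side taken. [cite: Mochizuki2012, IUTchIV Thm. 1.10 pp. 22–31; Cor. 2.2 (ii)–(iii) pp. 41–48]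
[cite: Mochizuki2012, IUTchIII Cor. 3.12 p. 173–174] [cite: MochizukiGenEll2010, Thm 2.1 p.12] [claim: Mochizuki2012, status: disputed] -/
theorem abcExpOn_farFromCusps_of_financed_mu_content_hregC (μ₀ : ℝ) (hμ₀ : 0 < μ₀) (hμ₁ : μ₀ ≤ 1)
    (σ : ∀ (P : NFPoint) (l : ℕ) (T : Cor22.ThetaVolumeDatumAt P l), letI := T.instFieldF; letI := T.instNumberFieldF; letI := T.instAlgebraF; letI := T.instFieldK;
        letI := T.instNumberFieldK; letI := T.instAlgebraK; letI := T.instFieldFbar; letI := T.instAlgebraFbar;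
        letI := T.instAlgebraKFbar; letI := T.instIsElliptic;
      Set (Fin (thetaIndex (pilotDataOfK T.D T.K)).lstar × (thetaIndex (pilotDataOfK T.D T.K)).VQ))
    -- [MU-fin-C] the FINANCED slack of `σ` is within the RELATIVE tolerance `(1 − μ₀)·T.gap + Tol(P,l)`, demanded ONLY on the content locus
    (hMuF : ∀ P : NFPoint, P ∈ UP → ∀ l : ℕ, l.Prime → 5 ≤ l →
      Cor22.AdmitsCore P → Cor22.CondP2 P l → Cor22.CondP5 P l → Cor22.CondP6 P l →
      6 * ((1 + 20 * (Cor22.dmod P : ℝ) / l) * (P.logDiff + Cor22.logCondAvoid P {2, l}))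
          + 120 * (2 ^ 12 * 3 ^ 3 * 5 * (Cor22.dmod P : ℝ) * l) < Cor22.logQAvoid P {2, l} →
      ∀ T : Cor22.ThetaVolumeDatumAt P l, letI := T.instFieldF; letI := T.instNumberFieldF; letI := T.instAlgebraF; letI := T.instFieldK;
        letI := T.instNumberFieldK; letI := T.instAlgebraK; letI := T.instFieldFbar; letI := T.instAlgebraFbar;
        letI := T.instAlgebraKFbar; letI := T.instIsElliptic;
      OffSigmaTolerance (1 - μ₀) (tol P l) T
        (weightedDeficit
          (settingPrVolSharp (pilotDataOfK T.D T.K) (logvAnalytic_analyticLogv (F := T.K)) (M P l T) (archPk P l T) (archSub P l T) (Ψ P l T)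
            (act P l T) (Mmod P l T) (region P l T) (n P l T) (lat P l T) (sig P l T) (split P l T) (qData P l T)
            (exists_realising_qIdeles_pilotDataOfK T.D).choose
            (exists_realising_thetaIdeles_pilotDataOfK T.D).choose
            (exists_realising_qIdeles_pilotDataOfK T.D).choose_spec.1
            (exists_realising_qIdeles_pilotDataOfK T.D).choose_spec.2.1) ((σ P l T).indicator fun _ => (1 : ℝ)) +
          offTrivialMass
          (settingPrVolSharp (pilotDataOfK T.D T.K) (logvAnalytic_analyticLogv (F := T.K)) (M P l T) (archPk P l T) (archSub P l T) (Ψ P l T)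
            (act P l T) (Mmod P l T) (region P l T) (n P l T) (lat P l T) (sig P l T) (split P l T) (qData P l T)
            (exists_realising_qIdeles_pilotDataOfK T.D).choose
            (exists_realising_thetaIdeles_pilotDataOfK T.D).choose
            (exists_realising_qIdeles_pilotDataOfK T.D).choose_spec.1
            (exists_realising_qIdeles_pilotDataOfK T.D).choose_spec.2.1) (σ P l T)))
    -- [CONE-C] abc-iut-C-cert-1's `hregC` VERBATIM (the off-regime hull estimate with print's `B_III(P,l)`, ONLY on the content locus)
    (hregC : ∀ P : NFPoint, P ∈ UP → ∀ l : ℕ, l.Prime → 5 ≤ l →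
      Cor22.AdmitsCore P → Cor22.CondP2 P l → Cor22.CondP5 P l → Cor22.CondP6 P l →
      6 * ((1 + 20 * (Cor22.dmod P : ℝ) / l) * (P.logDiff + Cor22.logCondAvoid P {2, l}))
          + 120 * (2 ^ 12 * 3 ^ 3 * 5 * (Cor22.dmod P : ℝ) * l) < Cor22.logQAvoid P {2, l} →
      ∀ T : Cor22.ThetaVolumeDatumAt P l,
        (letI := T.instFieldF; letI := T.instNumberFieldF; letI := T.instAlgebraF; letI := T.instFieldK
         letI := T.instNumberFieldK; letI := T.instAlgebraK; letI := T.instFieldFbar; letI := T.instAlgebraFbar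
         letI := T.instAlgebraKFbar; letI := T.instIsElliptic
         ¬ (∀ p ∈ T.I.supportPrimes, ∀ v w : placesOver (fieldOfModuli T.E) p,
            (Summit.ABC.IUTFork.DHData.ofInput T.I).logQloc p v = (Summit.ABC.IUTFork.DHData.ofInput T.I).logQloc p w)) →
        T.HullEstimateOf
          (((l : ℝ) + 1) / 4 *
            ((1 + 12 * (Cor22.dmod P : ℝ) / l) * (P.logDiff + Cor22.logCondAvoid P {2, l})
              + 2 * Real.log l + 52
              + 20 / 3 * Real.log (((2 ^ 12 * 3 ^ 3 * 5 * Cor22.dmod P : ℕ) : ℝ) * (l : ℝ))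
                * (Nat.primeCounting (2 ^ 12 * 3 ^ 3 * 5 * Cor22.dmod P * l) : ℝ))))
    {ρ : ℝ} (h0 : 0 < ρ) (h2 : ρ ≤ 1 / 2) :
    ABCWithExponentOn {P : NFPoint | P.FarFromCusps ({2} : Finset ℕ) ρ} (1 / μ₀) :=
  Cor312Slack.ABCExpOn_farFromCusps_of_cor312Slack_mu_content_hregC_degOne μ₀ hμ₀ hμ₁
    (fun P l T => letI := T.instFieldF; letI := T.instNumberFieldF; letI := T.instAlgebraF; letI := T.instFieldK;
        letI := T.instNumberFieldK; letI := T.instAlgebraK; letI := T.instFieldFbar; letI := T.instAlgebraFbar;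
        letI := T.instAlgebraKFbar; letI := T.instIsElliptic;
      weightedDeficit
          (settingPrVolSharp (pilotDataOfK T.D T.K) (logvAnalytic_analyticLogv (F := T.K)) (M P l T) (archPk P l T) (archSub P l T) (Ψ P l T)
            (act P l T) (Mmod P l T) (region P l T) (n P l T) (lat P l T) (sig P l T) (split P l T) (qData P l T)
            (exists_realising_qIdeles_pilotDataOfK T.D).choose
            (exists_realising_thetaIdeles_pilotDataOfK T.D).choose
            (exists_realising_qIdeles_pilotDataOfK T.D).choose_spec.1
            (exists_realising_qIdeles_pilotDataOfK T.D).choose_spec.2.1) ((σ P l T).indicator fun _ => (1 : ℝ)) +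
        offTrivialMass
          (settingPrVolSharp (pilotDataOfK T.D T.K) (logvAnalytic_analyticLogv (F := T.K)) (M P l T) (archPk P l T) (archSub P l T) (Ψ P l T)
            (act P l T) (Mmod P l T) (region P l T) (n P l T) (lat P l T) (sig P l T) (split P l T) (qData P l T)
            (exists_realising_qIdeles_pilotDataOfK T.D).choose
            (exists_realising_thetaIdeles_pilotDataOfK T.D).choose
            (exists_realising_qIdeles_pilotDataOfK T.D).choose_spec.1
            (exists_realising_qIdeles_pilotDataOfK T.D).choose_spec.2.1) (σ P l T))
    (fun P _ l _ _ _ _ _ _ _ T => by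
      letI := T.instFieldF; letI := T.instNumberFieldF; letI := T.instAlgebraF; letI := T.instFieldK
      letI := T.instNumberFieldK; letI := T.instAlgebraK; letI := T.instFieldFbar; letI := T.instAlgebraFbar
      letI := T.instAlgebraKFbar; letI := T.instIsElliptic
      have H := bridgeHyps_settingPrVolSharp_of_ideles (pilotDataOfK T.D T.K) (logvAnalytic_analyticLogv (F := T.K)) (M P l T) (archPk P l T)
        (archSub P l T) (Ψ P l T) (act P l T) (Mmod P l T) (region P l T) (n P l T) (lat P l T) (sig P l T) (split P l T) (qData P l T)
        (exists_realising_thetaIdeles_pilotDataOfK T.D).choose (exists_realising_qIdeles_pilotDataOfK T.D).choose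
        (exists_realising_thetaIdeles_pilotDataOfK T.D).choose_spec.1 (exists_realising_thetaIdeles_pilotDataOfK T.D).choose_spec.2.1
        (exists_realising_qIdeles_pilotDataOfK T.D).choose_spec.1 (exists_realising_qIdeles_pilotDataOfK T.D).choose_spec.2.1
      exact cor312UpTo_of_statementUpTo_chosen T (M P l T) (archPk P l T) (archSub P l T) (Ψ P l T) (act P l T) (Mmod P l T)
        (region P l T) (n P l T) (lat P l T) (sig P l T) (split P l T) (qData P l T) _
        (statementUpTo_onCharge_add_offTrivialMass H (σ P l T)))
    hMuF hregC h0 h2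

end Ends

end Summit.ABC.IUTFork.Conditional.SigmaMass

end
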